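import Mathlib.AlgebraicGeometry.EllipticCurve.Affine.Point
import Mathlib.AlgebraicGeometry.EllipticCurve.Reduction
import Mathlib.RingTheory.PowerSeries.Derivative
import Mathlib.RingTheory.PowerSeries.Inverse
import Mathlib.RingTheory.PowerSeries.Substitution
import Mathlib.NumberTheory.Padics.PadicIntegers
import Mathlib.Topology.Algebra.InfiniteSum.Basic
import Mathlib.Analysis.SpecialFunctions.Pow.Real
import HarnessLib

/-!
# The formal group of a Weierstrass curve: `w(z)`, the invariant differential, `log`, `exp`,
and the `p`-adic formal logarithm on `E₁(ℚ_p)`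

Trunk T-NT-EC (Literature/NumberTheory/EllipticCurves); definition request `defn-formalGroupLog`
(prerequisite of `defn-cyclotomicPAdicHeight`, route BirchSwinnertonDyer).

Following Silverman, *AEC* Ch. IV, for a Weierstrass curve `W` over a commutative ring `R` with the
local parameter `z = -x/y`, `w = -1/y` at `O`:

* `formalWStep W` — the contraction `w ↦ z³ + a₁ z w + a₂ z² w + a₃ w² + a₄ z w² + a₆ w³` of
  AEC IV.1.1, and `formalW W ∈ R⟦z⟧` — its unique fixed point `w(z) = z³(1 + a₁ z + (a₁² + a₂) z² + ⋯)`,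
  defined coefficientwise from the iterates (`coeff n` of the `n`-th iterate at `0`, which is
  stable since the `k`-th iterate is correct modulo `z^{k+3}`, AEC IV.1.1(a) proof).
* `formalWDivCube W = w(z)/z³`, `formalXMulSq W = z² x(z) = z³/w(z)`,
  `formalYMulCube W = z³ y(z) = -z³/w(z)` — the Laurent expansions of `x = z/w`, `y = -1/w`
  (AEC IV.1, display after 1.1) with the poles cleared, as honest power series.
* Over a `ℚ`-algebra `R`: the invariant differential `formalOmega W = ω(z)/dz`, computed from
  `ω = dx / (2y + a₁ x + a₃)` (AEC III.1.5, IV.1): with `w = z³ B`,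
  `ω/dz = (2B + z B') / (B (2 - a₁ z - a₃ z³ B))`; the formal logarithm
  `formalLog W = ∫ ω = z + ⋯` (AEC IV.4, IV.5: `log` of the formal group `Ê`), the formal
  exponential `formalExp W` (compositional inverse, Mathlib `PowerSeries.substInvOfIsUnit`) and the
  formal group law transported to `ℚ`-algebras, `formalGroupLawQ W (z₁, z₂) = exp (log z₁ + log z₂)`
  (AEC IV.5.5: over `R ⊗ ℚ`, `log : Ê → 𝔾̂ₐ` is an isomorphism, so this IS `F_W`).
* Over `ℚ_p`: the parameter `formalParameter P = -x(P)/y(P)` of an affine point, the kernel of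
  reduction `IsInReductionKernel P` (`P = O` or `‖x(P)‖ > 1`, i.e. `P` reduces to `Õ`;
  AEC VII.2), and the `p`-adic formal logarithm `padicFormalLog W t = Σ (coeff n log_W) tⁿ`
  (a `tsum`, junk `0` off the domain of convergence), `padicLogPoint W P = log_W(z(P))`.
* Named facts (nothing asserted): `summable_formalLog` and `summable_formalExp` (AEC IV.6.4:
  convergence of `log_Ê` on `pℤ_p` and of `exp_Ê` on `v(z) > 1/(p-1)`, for `p`-integral `W`) and
  `padicLogPoint_add` (AEC VII.2.2 + IV.6.4(a): for a MINIMAL `W/ℚ_p`, `E₁(ℚ_p)` is closed under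
  `+` and `P ↦ log_W z(P)` is additive on it).

## What is NOT delivered

A term of Mathlib's `FormalGroup R` (Mathlib/RingTheory/FormalGroup/Basic.lean) for general `R`:
its `assoc` field is the associativity of the chord-tangent law in `R⟦z₁, z₂⟧` (AEC IV.2), a
substantial formalisation. Over `ℚ`-algebras `formalGroupLawQ` is the underlying series; packaging
it as a `FormalGroup` needs `log ∘ exp = id` pushed through `MvPowerSeries.subst` and is left as
a follow-up. Consumers over `ℚ_p` (p-adic heights, Mazur–Tate `σ`) need `formalLog`,
`formalXMulSq` and the `p`-adic facts below, which do not depend on that packaging.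

## Sources

* J. H. Silverman, *The Arithmetic of Elliptic Curves*, 2nd ed., GTM 106 (2009), III.1.5, IV.1.1,
  IV.2, IV.4.2–4.3, IV.5.5, IV.6.4, VII.2.1–2.2 (`SilvermanAEC2009`).
* B. Mazur, J. Tate, J. Teitelbaum, *On `p`-adic analogues of the conjectures of Birch and
  Swinnerton-Dyer*, Invent. Math. 84 (1986), §II (`MazurTateTeitelbaum1986`).
* B. Mazur, W. Stein, J. Tate, *Computation of `p`-adic heights and log convergence*,
  Doc. Math. Extra Vol. Coates (2006), §3–4.
-/

noncomputable section

open PowerSeries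

namespace WeierstrassCurve

variable {R : Type*} [CommRing R] (W : WeierstrassCurve R)

/-! ### `w(z)` and the Laurent expansions of `x`, `y` -/

/-- The contraction of AEC IV.1.1: `f(w) = z³ + a₁ z w + a₂ z² w + a₃ w² + a₄ z w² + a₆ w³`
(the Weierstrass equation in the `(z, w)`-plane, `z = -x/y`, `w = -1/y`, solved for `w`).
[Silverman AEC IV.1, eq. before Prop. 1.1] [cite: SilvermanAEC2009, IV.1.1] -/
def formalWStep (w : R⟦X⟧) : R⟦X⟧ :=
  X ^ 3 + C W.a₁ * X * w + C W.a₂ * X ^ 2 * w + C W.a₃ * w ^ 2 + C W.a₄ * X * w ^ 2 +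
    C W.a₆ * w ^ 3

/-- **`w(z) ∈ R⟦z⟧`**, the unique power series with `w = f(w)`, i.e. the expansion of `w = -1/y` in
the local parameter `z = -x/y` at `O`:
`w(z) = z³ + a₁ z⁴ + (a₁² + a₂) z⁵ + (a₁³ + 2a₁a₂ + a₃) z⁶ + ⋯`. Defined coefficientwise: the
`n`-th coefficient of the `n`-th iterate `fⁿ(0)` (the `k`-th iterate agrees with `w` modulo
`z^{k+3}`, AEC IV.1.1(a) and its proof via Hensel). [Silverman AEC IV.1.1(a)] [cite: SilvermanAEC2009, IV.1.1] -/
def formalW : R⟦X⟧ :=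
  PowerSeries.mk fun n => coeff n ((formalWStep W)^[n] 0)

/-- `B(z) = w(z)/z³ = 1 + a₁ z + (a₁² + a₂) z² + ⋯ ∈ R⟦z⟧` (shift of `w` by three).
[Silverman AEC IV.1.1(a)] [cite: SilvermanAEC2009, IV.1.1] -/
def formalWDivCube : R⟦X⟧ :=
  PowerSeries.mk fun n => coeff (n + 3) W.formalW

/-- `z² · x(z) = z³/w(z) = 1 - a₁ z - a₂ z² - a₃ z³ + ⋯ ∈ R⟦z⟧`: the Laurent expansion
`x(z) = z/w(z) = z⁻² - a₁ z⁻¹ - a₂ - a₃ z - ⋯` with the double pole cleared (inverse of `B`, which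
has constant term `1`). [Silverman AEC IV.1, expansions after Prop. 1.1] [cite: SilvermanAEC2009, IV.1.1] -/
def formalXMulSq : R⟦X⟧ :=
  PowerSeries.invOfUnit W.formalWDivCube 1

/-- `z³ · y(z) = -z³/w(z) = -1 + a₁ z + ⋯ ∈ R⟦z⟧`: the Laurent expansion
`y(z) = -1/w(z) = -z⁻³ + a₁ z⁻² + ⋯` with the triple pole cleared.
[Silverman AEC IV.1, expansions after Prop. 1.1] [cite: SilvermanAEC2009, IV.1.1] -/
def formalYMulCube : R⟦X⟧ :=
  -PowerSeries.invOfUnit W.formalWDivCube 1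

/-! ### Over `ℚ`-algebras: invariant differential, `log`, `exp`, the group law -/

section RatAlgebra

variable {A : Type*} [CommRing A] [Algebra ℚ A] (W : WeierstrassCurve A)

/-- `2` is a unit in a `ℚ`-algebra. [folklore] -/
def unitTwo : Aˣ where
  val := 2
  inv := algebraMap ℚ A 2⁻¹
  val_inv := by
    rw [← map_ofNat (algebraMap ℚ A) 2, ← map_mul]; norm_num
  inv_val := by
    rw [← map_ofNat (algebraMap ℚ A) 2, ← map_mul]; norm_num

/-- **The invariant differential** `ω(z)/dz ∈ A⟦z⟧` of `W` over a `ℚ`-algebra, from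
`ω = dx/(2y + a₁ x + a₃)` (AEC III.1.5) in the parameter `z`: writing `w = z³ B`,
`x = z/w`, `y = -1/w` gives `ω/dz = (2B + z B') / (B · (2 - a₁ z - a₃ z³ B))`, whose denominator
has constant term `2` (a unit here). Expansion: `1 + a₁ z + (a₁² + a₂) z² + ⋯` (AEC IV.1); it is
the normalised invariant differential of the formal group `Ê` (AEC IV.4.2–4.3), and in fact has
coefficients in `ℤ[a₁, …, a₆]`. [Silverman AEC IV.1 (expansion of `ω(z)`), IV.4.2] [cite: SilvermanAEC2009, IV.4.2] -/
def formalOmega : A⟦X⟧ :=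
  (2 * W.formalWDivCube + X * d⁄dX A W.formalWDivCube) *
    PowerSeries.invOfUnit
      (W.formalWDivCube * (2 - C W.a₁ * X - C W.a₃ * X ^ 3 * W.formalWDivCube)) unitTwo

/-- **The formal logarithm** `log_W(z) = ∫₀ᶻ ω = z + (a₁/2) z² + ((a₁² + a₂)/3) z³ + ⋯ ∈ A⟦z⟧`
(term-by-term integration of `formalOmega`; the linear coefficient is `ω(0) = 1`).
[Silverman AEC IV.4, IV.5 (formal logarithm `log_F = ∫ ω_F`), IV.5.5] [cite: SilvermanAEC2009, IV.5.5] -/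
def formalLog : A⟦X⟧ :=
  PowerSeries.mk fun n =>
    match n with
    | 0 => 0
    | 1 => 1
    | n + 2 => algebraMap ℚ A (1 / (n + 2 : ℚ)) * coeff (n + 1) W.formalOmega

/-- `log_W(0) = 0`. [Silverman AEC IV.5] [folklore] -/
@[simp] theorem constantCoeff_formalLog : constantCoeff W.formalLog = 0 := by
  rw [← coeff_zero_eq_constantCoeff_apply, formalLog, coeff_mk]

/-- `log_W(z) = z + O(z²)`. [Silverman AEC IV.5.5 (`log_F(T) = T + ⋯`)] [folklore] -/
@[simp] theorem coeff_one_formalLog : coeff 1 W.formalLog = 1 := by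
  simp [formalLog, coeff_mk]

/-- The linear coefficient of `log_W` is a unit. [folklore] -/
theorem isUnit_coeff_one_formalLog : IsUnit (coeff 1 W.formalLog) := by
  rw [coeff_one_formalLog]; exact isUnit_one

/-- **The formal exponential** `exp_W = log_W⁻¹` (compositional inverse; Mathlib
`PowerSeries.substInvOfIsUnit`). [Silverman AEC IV.5.5 (`exp_F`)] [cite: SilvermanAEC2009, IV.5.5] -/
def formalExp : A⟦X⟧ :=
  PowerSeries.substInvOfIsUnit W.formalLog W.isUnit_coeff_one_formalLog

/-- `log_W (exp_W z) = z`. [Silverman AEC IV.5.5] [folklore] -/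
theorem formalLog_subst_formalExp : W.formalLog.subst W.formalExp = X :=
  subst_substInvOfIsUnit_right _ W.constantCoeff_formalLog _

/-- `exp_W (log_W z) = z`. [Silverman AEC IV.5.5] [folklore] -/
theorem formalExp_subst_formalLog : W.formalExp.subst W.formalLog = X :=
  subst_substInvOfIsUnit_left _ W.constantCoeff_formalLog _

/-- `exp_W(0) = 0`. [Silverman AEC IV.5.5] [folklore] -/
@[simp] theorem constantCoeff_formalExp : constantCoeff W.formalExp = 0 :=
  constantCoeff_substInvOfIsUnit _ _

/-- **The formal group law over a `ℚ`-algebra**: `F_W(z₁, z₂) = exp_W (log_W z₁ + log_W z₂)`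
`∈ A⟦z₁, z₂⟧` (variables `X 0`, `X 1`). By AEC IV.5.5, over `R ⊗ ℚ` the formal logarithm is an
isomorphism `Ê ⥲ 𝔾̂ₐ`, so this is the formal group law `F_W` of AEC IV.2 base-changed to `A`.
(Not packaged as a Mathlib `FormalGroup A`; see the module doc.) [Silverman AEC IV.2, IV.5.5] [cite: SilvermanAEC2009, IV.5.5] -/
def formalGroupLawQ : MvPowerSeries (Fin 2) A :=
  W.formalExp.subst
    (W.formalLog.subst (MvPowerSeries.X 0 : MvPowerSeries (Fin 2) A) +
      W.formalLog.subst (MvPowerSeries.X 1 : MvPowerSeries (Fin 2) A))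

end RatAlgebra

/-! ### Over `ℚ_p`: the parameter `z(P)`, `E₁(ℚ_p)` and the `p`-adic formal logarithm -/

section Padic

open scoped Classical

variable {p : ℕ} [Fact p.Prime] (W : WeierstrassCurve ℚ_[p])

/-- The local parameter `z(P) = -x(P)/y(P)` of an affine point (`z(O) = 0`; junk `0` when
`y(P) = 0`, by `x / 0 = 0`). [Silverman AEC IV.1 (`z = -x/y`), VII.2.2] [cite: SilvermanAEC2009, VII.2.2] -/
def formalParameter : W.toAffine.Point → ℚ_[p]
  | .zero => 0
  | .some x y _ => -x / y

/-- **The kernel of reduction `E₁(ℚ_p)`** (for a `p`-integral, e.g. minimal, equation): `P = O` or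
`P = (x, y)` with `‖x‖_p > 1` (equivalently `v_p(x) < 0`, equivalently `P` reduces to `Õ`; then
`v_p(x) = -2k`, `v_p(y) = -3k`, `v_p(z(P)) = k ≥ 1`). [Silverman AEC VII.2 (definition of
`E₁(K)`), VII.2.2] [cite: SilvermanAEC2009, VII.2.2] -/
def IsInReductionKernel : W.toAffine.Point → Prop
  | .zero => True
  | .some x _ _ => 1 < ‖x‖

/-- **The `p`-adic formal logarithm** `log_W(t) = Σₙ (coeff n log_W) tⁿ ∈ ℚ_p`, as a `tsum`
(junk `0` where the series does not converge; it converges for `‖t‖ < 1` when `W` is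
`p`-integral, `summable_formalLog`). [Silverman AEC IV.6.4; Mazur–Stein–Tate 2006, §3] [cite: SilvermanAEC2009, IV.6.4] -/
def padicFormalLog (t : ℚ_[p]) : ℚ_[p] :=
  ∑' n : ℕ, coeff n W.formalLog * t ^ n

/-- `log_W(z(P))`, the `p`-adic formal logarithm of a point (meaningful on `E₁(ℚ_p)`): the map
`E₁(ℚ_p) → pℤ_p → ℚ_p`, `P ↦ z(P) = -x/y ↦ log_W(z(P))`. [Silverman AEC IV.6.4, VII.2.2;
Mazur–Tate–Teitelbaum 1986, §II] [cite: SilvermanAEC2009, IV.6.4] -/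
def padicLogPoint (P : W.toAffine.Point) : ℚ_[p] :=
  W.padicFormalLog (W.formalParameter P)

/-! ### Named facts (nothing asserted) -/

/-- **AEC IV.6.4(a) for `Ê`**: if `W/ℚ_p` has `p`-integral coefficients, `log_W` converges on the
maximal ideal `pℤ_p`, i.e. for `‖t‖_p < 1` (its coefficients are `bₙ/n` with `bₙ ∈ ℤ_p`, since
`ω` has coefficients in `ℤ[a₁, …, a₆]`, AEC IV.4.3, and `‖bₙ tⁿ/n‖ ≤ n ‖t‖ⁿ → 0`).
[Silverman AEC IV.6.4(a), IV.5.5] [cite: SilvermanAEC2009, IV.6.4] -/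
def summable_formalLog : Prop :=
  ∀ (p : ℕ) [Fact p.Prime] (W : WeierstrassCurve ℚ_[p]) [W.IsIntegral ℤ_[p]] (t : ℚ_[p]),
    ‖t‖ < 1 → Summable fun n : ℕ => coeff n W.formalLog * t ^ n

/-- **AEC IV.6.4(b) for `Ê`**: if `W/ℚ_p` has `p`-integral coefficients, `exp_W` converges for
`v_p(t) > v_p(p)/(p - 1) = 1/(p-1)`, i.e. `‖t‖_p < p^{-1/(p-1)}`.
[Silverman AEC IV.6.4(b)] [cite: SilvermanAEC2009, IV.6.4] -/
def summable_formalExp : Prop :=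
  ∀ (p : ℕ) [Fact p.Prime] (W : WeierstrassCurve ℚ_[p]) [W.IsIntegral ℤ_[p]] (t : ℚ_[p]),
    ‖t‖ < (p : ℝ) ^ (-(1 / ((p : ℝ) - 1))) → Summable fun n : ℕ => coeff n W.formalExp * t ^ n

/-- **`log_W ∘ z` is a homomorphism on `E₁(ℚ_p)`** (minimal Weierstrass equation over `ℚ_p`):
`E₁(ℚ_p)` is closed under the group law and `log_W z(P + Q) = log_W z(P) + log_W z(Q)` for
`P, Q ∈ E₁(ℚ_p)` — the composite of the isomorphism `E₁(ℚ_p) ≅ Ê(pℤ_p)`, `P ↦ z(P)`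
(AEC VII.2.2) with the homomorphism `log_Ê : Ê(pℤ_p) → ℚ_p` (AEC IV.6.4(a)).
[Silverman AEC VII.2.2, IV.6.4(a); Mazur–Tate–Teitelbaum 1986, §II] [cite: SilvermanAEC2009, VII.2.2] -/
def padicLogPoint_add : Prop :=
  ∀ (p : ℕ) [Fact p.Prime] (W : WeierstrassCurve ℚ_[p]) [W.IsMinimal ℤ_[p]]
    (P Q : W.toAffine.Point), W.IsInReductionKernel P → W.IsInReductionKernel Q →
      W.IsInReductionKernel (P + Q) ∧
        W.padicLogPoint (P + Q) = W.padicLogPoint P + W.padicLogPoint Q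

/-! ### API -/

/-- `z(O) = 0`. [Silverman AEC IV.1] [folklore] -/
@[simp] theorem formalParameter_zero : W.formalParameter 0 = 0 := rfl

/-- `z(x, y) = -x/y`. [Silverman AEC IV.1] [folklore] -/
theorem formalParameter_some {x y : ℚ_[p]} (h : W.toAffine.Nonsingular x y) :
    W.formalParameter (.some x y h) = -x / y := rfl

/-- `O ∈ E₁(ℚ_p)`. [Silverman AEC VII.2] [folklore] -/
@[simp] theorem isInReductionKernel_zero : W.IsInReductionKernel 0 := by
  change True; trivial

/-- `(x, y) ∈ E₁(ℚ_p) ↔ ‖x‖ > 1`. [Silverman AEC VII.2] [folklore] -/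
theorem isInReductionKernel_some {x y : ℚ_[p]} (h : W.toAffine.Nonsingular x y) :
    W.IsInReductionKernel (.some x y h) ↔ 1 < ‖x‖ := Iff.rfl

/-- `log_W(0) = 0` in `ℚ_p` (only the `n = 0` term survives, and `log_W` has no constant term).
[Silverman AEC IV.6.4] [folklore] -/
@[simp] theorem padicFormalLog_zero : W.padicFormalLog 0 = 0 := by
  unfold padicFormalLog
  rw [tsum_eq_single 0 fun n hn => by simp [zero_pow hn]]
  simp

/-- `log_W z(O) = 0`. [Silverman AEC IV.6.4] [folklore] -/
@[simp] theorem padicLogPoint_zero : W.padicLogPoint 0 = 0 := by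
  simp [padicLogPoint]

end Padic

/-! ### API for `w(z)` -/

/-- `w(z)` has no constant term. [Silverman AEC IV.1.1(a)] [folklore] -/
@[simp] theorem constantCoeff_formalW : constantCoeff W.formalW = 0 := by
  rw [← coeff_zero_eq_constantCoeff_apply, formalW, coeff_mk]
  simp

/-- On multiples of `z³` the contraction is `z³ + z⁴ · (…)`. [Silverman AEC IV.1.1(a) proof] [folklore] -/
theorem formalWStep_X_pow_mul (u : R⟦X⟧) :
    W.formalWStep (X ^ 3 * u) = X ^ 3 + X ^ 4 * (C W.a₁ * u + C W.a₂ * X * u +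
      C W.a₃ * X ^ 2 * u ^ 2 + C W.a₄ * X ^ 3 * u ^ 2 + C W.a₆ * X ^ 5 * u ^ 3) := by
  unfold formalWStep; ring

/-- Every iterate `fᵏ(0)` is a multiple of `z³`. [Silverman AEC IV.1.1(a) proof] [folklore] -/
theorem X_pow_three_dvd_iterate_formalWStep (k : ℕ) : X ^ 3 ∣ (W.formalWStep)^[k] 0 := by
  induction k with
  | zero => exact dvd_zero _
  | succ k ih =>
    obtain ⟨u, hu⟩ := ih
    rw [Function.iterate_succ_apply', hu, formalWStep_X_pow_mul]
    exact dvd_add dvd_rfl (dvd_mul_of_dvd_left (pow_dvd_pow X (by norm_num)) _)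

/-- `w(z) = z³ + O(z⁴)`: the cubic coefficient is `1`. [Silverman AEC IV.1.1(a)] [folklore] -/
theorem coeff_three_formalW : coeff 3 W.formalW = 1 := by
  rw [formalW, coeff_mk, Function.iterate_succ_apply']
  obtain ⟨u, hu⟩ := W.X_pow_three_dvd_iterate_formalWStep 2
  rw [hu, formalWStep_X_pow_mul, map_add, coeff_X_pow_mul', coeff_X_pow]
  simp

/-- `w(z) = z³ + O(z⁴)`: no terms of degree `< 3`. [Silverman AEC IV.1.1(a)] [folklore] -/
theorem coeff_formalW_of_lt_three {n : ℕ} (hn : n < 3) : coeff n W.formalW = 0 := by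
  rw [formalW, coeff_mk]
  obtain ⟨u, hu⟩ := W.X_pow_three_dvd_iterate_formalWStep n
  rw [hu, coeff_X_pow_mul']
  simp [show ¬ 3 ≤ n by omega]

/-- Hence `B(0) = 1` for `B = w/z³`. [Silverman AEC IV.1.1(a)] [folklore] -/
@[simp] theorem constantCoeff_formalWDivCube : constantCoeff W.formalWDivCube = 1 := by
  rw [← coeff_zero_eq_constantCoeff_apply, formalWDivCube, coeff_mk, zero_add, coeff_three_formalW]

/-- And `z² x(z) = 1 + O(z)` (`x` has a double pole with leading coefficient `1`).
[Silverman AEC IV.1] [folklore] -/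
@[simp] theorem constantCoeff_formalXMulSq : constantCoeff W.formalXMulSq = 1 := by
  rw [formalXMulSq, constantCoeff_invOfUnit, inv_one, Units.val_one]

/-- `B · (z² x) = 1`, i.e. `x(z) · w(z) = z`. [Silverman AEC IV.1 (`x = z/w`)] [folklore] -/
theorem formalWDivCube_mul_formalXMulSq : W.formalWDivCube * W.formalXMulSq = 1 :=
  mul_invOfUnit _ _ (by simp)

/-- `ω(0) = 1` over a `ℚ`-algebra (so `ω/dz = 1 + O(z)`, consistent with `log_W = z + O(z²)`).
[Silverman AEC IV.1, IV.4.2] [folklore] -/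
theorem constantCoeff_formalOmega {A : Type*} [CommRing A] [Algebra ℚ A] (W : WeierstrassCurve A) :
    constantCoeff W.formalOmega = 1 := by
  have h2 : constantCoeff (2 : A⟦X⟧) = 2 := map_ofNat _ 2
  simp only [formalOmega, map_mul, map_add, constantCoeff_invOfUnit, constantCoeff_X,
    zero_mul, add_zero, constantCoeff_formalWDivCube, mul_one, h2]
  exact unitTwo.mul_inv

end WeierstrassCurve
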